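import Summits.QuantumAdvantage.QuantumAdvantage.Theorems.HintDialPlanting

/-!
# HintDialClosure — module 6/10 of the HintDial THEOREMS package (cell decomp-qadv, lens-3 generation 6)

§4d: closure — `not_promiseLift_AC0Mod_of_proj` (generic planted-projection tool), the `MOD₃` closure `not_promiseLift_AC0Mod2_of_planted`, and the PARITY planting `signedExact_not_AC0Mod_odd` (every odd prime).

Provenance: split of the farm-checked single file `HintDialTheorems.lean` (HOME/decomp-qadv-lens-3/g6/tree/; rc 0 · no proof holes ·
axioms ⊆ {propext, Classical.choice, Quot.sound}); mathematical record: HOME/decomp-qadv-lens-3/g6/NODE-g6.md.  Modules in order: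
HintDialDuality → HintDialLevels → HintDialAutomaton → HintDialLeakLaw → HintDialPlanting → HintDialClosure → HintDialTable → HintDialLowDegree → HintDialAnfLadder → HintDialCovariance (each imports its predecessor).  Namespace `Summit.QuantumAdvantage.QuantumAdvantage.Theorems.HintDial`.
-/

set_option linter.dupNamespace false

noncomputable section

namespace Summit.QuantumAdvantage.QuantumAdvantage.Theorems.HintDial

open Finset
open Literature.Computability.Complexity
open Literature.Computability.QuantumComplexity
open Literature.Computability.MetaComplexity
open _root_.Computability (encodeNat)
namespace Automaton

open CubicForm (bit)
open DerivativeWalsh (W)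
open BuzetChailloux (bxor zeroVec)

variable {m : ℕ}
variable (w : Fin m → Bool)

/-! ### Closure: an `AC⁰[⊕]` family separating the planted instances decides `MOD₃` -/

/-- Every symbol is realised over `accBasis p` (any `p`) within depth `1`, size `1`. -/
theorem acRealOver_evalLit (p : ℕ) (ℓ : Lit m) : ACRealOver (accBasis p) (fun w : Fin m → Bool => evalLit w ℓ) 1 1 := by
  rcases ℓ with c | ⟨ng, i⟩
  · exact acRealOver_const (acBasis_subset_accBasis p) c
  · cases ng
    · exact ((acRealOver_input (accBasis p) i).mono zero_le_one zero_le_one).congr fun w => (Bool.false_xor _).symm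
    · exact ((acRealOver_notInput (Smolensky.not_mem_accBasis p) i).mono zero_le_one le_rfl).congr fun w => by
        show (!w i) = xor true (w i); cases w i <;> rfl

/-- HintDial helper `ofFn_evalLit` (lens-3 g6 HintDial THEOREMS package; see the enclosing section docstring). -/
theorem ofFn_evalLit (S : List (Lit m)) (u : Fin m → Bool) :
    List.ofFn (fun p : Fin S.length => evalLit u (S.get p)) = S.map (evalLit u) := by
  rw [show (fun p : Fin S.length => evalLit u (S.get p)) = evalLit u ∘ S.get from rfl, ← List.map_ofFn, List.ofFn_get]

/-- ★★ GENERIC PLANTED-PROJECTION CLOSURE (the reusable tool of this node).  Let `p ≠ q` be primes and `Φₘ : {0,1}^m → {0,1}^*`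
a family of LITERAL PROJECTIONS of polynomially bounded length such that `Φₘ(w)` is a YES instance of `Q` when `#₁(w) ≡ 0 (mod q)`
and a NO instance otherwise.  Then `Q ∉ promiseLift AC⁰[p]` — by composing a separating `AC⁰[p]` family with the projections
(`ACRealOver` calculus: depth `+1`, size `+ℓ`) and Smolensky's theorem `MOD_q ∉ AC⁰[p]` (`Smolensky1987_modq_not_mem_AC0Mod_holds`,
fully PROVED in the tree). -/
theorem not_promiseLift_AC0Mod_of_proj {p q : ℕ} (hp : p.Prime) (hq : q.Prime) (hpq : p ≠ q) (Q : PromiseProblem)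
    (Φ : (m : ℕ) → (Fin m → Bool) → List Bool) (hΦ : ∀ m, IsProj (Φ m)) (P : Polynomial ℕ)
    (hlenP : ∀ (m : ℕ) (w : Fin m → Bool), (Φ m w).length ≤ P.eval m)
    (hQy : ∀ (m : ℕ) (w : Fin m → Bool), GateFn.numOnes w % q = 0 → Φ m w ∈ Q.yes)
    (hQn : ∀ (m : ℕ) (w : Fin m → Bool), ¬ GateFn.numOnes w % q = 0 → Φ m w ∈ Q.no) :
    Q ∉ promiseLift (AC0Mod p) := by
  rintro ⟨L, ⟨d, r, C, hC, hDec⟩, hyes, hno⟩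
  apply Smolensky1987_modq_not_mem_AC0Mod_holds p q hp hq hpq
  choose S hS using hΦ
  -- the composed family: for each `m`, the circuit `C ℓ` on the `ℓ = |S m|` literals
  have hR : ∀ m : ℕ, ∃ D : Circuit (Fin m), D.IsOver (accBasis p) ∧ D.acDepth ≤ d + 1 ∧
      D.size ≤ r.eval (S m).length + (S m).length ∧
      D.Computes fun w => (C (S m).length).eval fun j => evalLit w ((S m).get j) := by
    intro m
    have h := acRealOver_circuit_comp (C (S m).length) (hC _).1 (fun j => acRealOver_evalLit p ((S m).get j))
    refine (h.mono ?_ ?_).toCircuit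
    · exact Nat.add_le_add_right (hC _).2.1 1
    · refine Nat.add_le_add (hC _).2.2 (le_of_eq ?_)
      simp
  choose D hD using hR
  have hlen : ∀ m, (S m).length ≤ P.eval m := fun m => by
    have := hS m fun _ => false
    calc (S m).length = ((S m).map (evalLit fun _ => false)).length := (List.length_map _).symm
      _ = (Φ m fun _ => false).length := by rw [← this]
      _ ≤ _ := hlenP m _
  refine ⟨d + 1, r.comp P + P, D, fun m => ⟨(hD m).1, (hD m).2.1, (hD m).2.2.1.trans ?_⟩, fun x => ?_⟩
  · show _ ≤ (r.comp P + P).eval m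
    rw [Polynomial.eval_add, Polynomial.eval_comp]
    exact Nat.add_le_add (natPoly_eval_mono r (hlen m)) (hlen m)
  · -- correctness on input `x`
    rw [(hD x.length).2.2.2 x.get]
    beta_reduce
    rw [hDec.eval_eq, ofFn_evalLit, ← hS]
    by_cases h3 : GateFn.numOnes x.get % q = 0
    · rw [(Set.mem_iff_boolIndicator _ _).1 (hyes (hQy _ x.get h3))]
      symm; rw [← Set.mem_iff_boolIndicator]
      show x.count true % q = 0
      rwa [Smolensky.count_true_eq_numOnes_get]
    · rw [(Set.notMem_iff_boolIndicator _ _).1 (hno (hQn _ x.get h3))]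
      symm; rw [← Set.notMem_iff_boolIndicator]
      show ¬ x.count true % q = 0
      rwa [Smolensky.count_true_eq_numOnes_get]

/-- ★★ The `MOD₃`-planting instance (`p = 2`, `q = 3`, family `inst`): a promise problem that puts `code(inst w)` on its YES side
when `MOD₃(w) = 0` and on its NO side otherwise is not in `promiseLift AC⁰[⊕]`. -/
theorem not_promiseLift_AC0Mod2_of_planted (Q : PromiseProblem)
    (hQy : ∀ (m : ℕ) (w : Fin m → Bool), GateFn.numOnes w % 3 = 0 → (inst w).encode ∈ Q.yes)
    (hQn : ∀ (m : ℕ) (w : Fin m → Bool), ¬ GateFn.numOnes w % 3 = 0 → (inst w).encode ∈ Q.no) :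
    Q ∉ promiseLift (AC0Mod 2) :=
  not_promiseLift_AC0Mod_of_proj Nat.prime_two Nat.prime_three (by decide) Q (fun _ w => (inst w).encode)
    (fun _ => isProj_encode_inst) uPoly (fun _ w => length_encode_inst_le w) hQy hQn

/-- ★ LEVEL-2 LEAK (kernel-checked witness of the planting law): in the `MOD₃` planting the dual bit IS one of the dual's
QUADRATIC coefficients — the cross entry `(a₀,a₀ | b₀)` of `G₀` — so the same family is trivially decidable at hint level `2`
(read one revealed coefficient); the level-`3` theorem does not lift to level `2` by this planting. -/
theorem G0_level2_leak :
    (G0 w).cube (finSumFinEquiv (Sum.inl a₀)) (finSumFinEquiv (Sum.inl a₀)) (finSumFinEquiv (Sum.inr b₀)) = (G0 w).const := by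
  show (decide ((finSumFinEquiv (Sum.inl a₀) : Fin (kk m + kk m)) = finSumFinEquiv (Sum.inl a₀)) &&
      MM (fun a => rEnt w b₀ a) (fun a b => rEnt w b a) (zv w)
        (finSumFinEquiv.symm (finSumFinEquiv (Sum.inl a₀))) (finSumFinEquiv.symm (finSumFinEquiv (Sum.inr b₀)))) = zv w b₀
  rw [Equiv.symm_apply_apply, Equiv.symm_apply_apply, decide_eq_true rfl, Bool.true_and]
  rfl

/-- HintDial helper `posDeg_level2_leak` (lens-3 g6 HintDial THEOREMS package; see the enclosing section docstring). -/
theorem posDeg_level2_leak :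
    posDeg (finSumFinEquiv (Sum.inl (a₀ : Fin (kk m)))) (finSumFinEquiv (Sum.inl a₀)) (finSumFinEquiv (Sum.inr (b₀ : Fin (kk m)))) = 2 := by
  have hne : finSumFinEquiv (Sum.inl (a₀ : Fin (kk m))) ≠ finSumFinEquiv (Sum.inr (b₀ : Fin (kk m))) := fun h => by
    have := finSumFinEquiv.injective h; cases this
  unfold posDeg
  rw [Finset.card_eq_two]
  exact ⟨_, _, hne, by simp⟩

/-! ### ★★ NEW (g6): THE PARITY PLANTING — the target slice itself (hint level 1, FULL dual table) beats `AC⁰[p]` for every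
ODD prime `p`.  Planted pair on `n = 2m`: `F_w(x′,x″) = ⟨w,x′⟩ ⊕ ⟨x′,x″⟩ ⊕ ⟨𝟙,x″⟩` (inner product with affine shifts), whose dual is
`G_w(y′,y″) = ⟨𝟙,w⟩ ⊕ ⟨𝟙,y′⟩ ⊕ ⟨y′,y″⟩ ⊕ ⟨w,y″⟩` — every coefficient a literal of `w` EXCEPT the constant `⟨𝟙,w⟩ = PARITY(w)`.
The reduction outputs `(F_w, G_w with constant 0)`: a YES instance iff `PARITY(w) = 0`, a NO instance iff `PARITY(w) = 1`. -/

/-- the identity pattern (so that `mv dM x = x`) -/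
def dM : Fin m → Fin m → Bool := fun a b => decide (b = a)

/-- the all-ones vector -/
def ones : Fin m → Bool := fun _ => true

/-- HintDial helper `mv_dM` (lens-3 g6 HintDial THEOREMS package; see the enclosing section docstring). -/
theorem mv_dM (x : Fin m → Bool) : mv dM x = x := funext fun a => bd_sgl_left a x

/-- `⟨𝟙, w⟩ = PARITY(w)`. -/
theorem bd_ones (w : Fin m → Bool) : bd ones w = decide (Odd (GateFn.numOnes w)) := by
  unfold bd GateFn.numOnes
  have h : (univ.filter fun i => ones i && w i) = univ.filter fun i => w i = true :=
    Finset.filter_congr fun i _ => by simp [ones]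
  rw [h]

/-- ★ the planted function `F_w`. -/
def Fp : CubicForm (m + m) := blTable m false w dM ones

/-- ★ its dual `G_w` (constant = `PARITY(w)`), -/
def Gp : CubicForm (m + m) := blTable m (bd ones w) ones dM w

/-- and the table the reduction outputs (the dual with its constant ZEROED). -/
def Gp0 : CubicForm (m + m) := blTable m false ones dM w

/-- HintDial helper `eval_Fp` (lens-3 g6 HintDial THEOREMS package; see the enclosing section docstring). -/
theorem eval_Fp (x₁ x₂ : Fin m → Bool) : (Fp w).eval (Fin.append x₁ x₂) = xor (xor (bd w x₁) (bd x₁ x₂)) (bd ones x₂) := by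
  rw [Fp, eval_blTable, Bool.false_xor, mv_dM]

/-- HintDial helper `eval_Gp` (lens-3 g6 HintDial THEOREMS package; see the enclosing section docstring). -/
theorem eval_Gp (y₁ y₂ : Fin m → Bool) :
    (Gp w).eval (Fin.append y₁ y₂) = xor (xor (xor (bd ones w) (bd ones y₁)) (bd y₁ y₂)) (bd w y₂) := by
  rw [Gp, eval_blTable, mv_dM]

/-- HintDial helper `bxor_left_eq_iff` (lens-3 g6 HintDial THEOREMS package; see the enclosing section docstring). -/
theorem bxor_left_eq_iff (a x y : Fin m → Bool) : bxor a x = y ↔ x = bxor a y := by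
  constructor
  · rintro rfl; funext i; show x i = xor (a i) (xor (a i) (x i)); cases a i <;> simp
  · rintro rfl; funext i; show xor (a i) (xor (a i) (y i)) = y i; cases a i <;> simp

/-- ★ THE WALSH TRANSFORM OF `(-1)^{F_w}`: `W(y′,y″) = 2^m · (-1)^{⟨𝟙, w ⊕ y′⟩ ⊕ ⟨w ⊕ y′, y″⟩}`. -/
theorem W_Fp (y₁ y₂ : Fin m → Bool) :
    W (fun x => signOf ((Fp w).eval x)) (Fin.append y₁ y₂) = 2 ^ m * (twist ones (bxor w y₁) * twist (bxor w y₁) y₂) := by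
  rw [DerivativeWalsh.W, sum_append]
  simp_rw [eval_Fp, twist_append, signOf_xor, signOf_bd]
  rw [sum_comm]
  have inner : ∀ x₂ : Fin m → Bool,
      ∑ x₁ : Fin m → Bool, twist w x₁ * twist x₁ x₂ * twist ones x₂ * (twist x₁ y₁ * twist x₂ y₂)
        = (twist ones x₂ * twist x₂ y₂) * (if x₂ = bxor w y₁ then (2 : ℝ) ^ m else 0) := by
    intro x₂
    have e : ∀ x₁ : Fin m → Bool, twist w x₁ * twist x₁ x₂ * twist ones x₂ * (twist x₁ y₁ * twist x₂ y₂)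
        = (twist ones x₂ * twist x₂ y₂) * twist x₁ (bxor (bxor w x₂) y₁) := fun x₁ => by
      rw [Literature.Computability.QuantumComplexity.BuzetChailloux.twist_bxor_right, Literature.Computability.QuantumComplexity.BuzetChailloux.twist_bxor_right, twist_comm w x₁]; ring
    simp_rw [e]
    rw [← mul_sum, BuzetChailloux.sum_twist_left]
    simp only [BuzetChailloux.bxor_eq_zeroVec_iff]
    simp only [bxor_left_eq_iff]
  simp_rw [inner, mul_ite, mul_zero, Finset.sum_ite_eq', Finset.mem_univ, if_true]
  ring

/-- ★★ `G_w` IS THE DUAL OF `F_w`; hence `Φ(F_w, G_w) = 1`. -/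
theorem isDualOf_Fp_Gp : IsDualOf (Fp w).eval (Gp w).eval := by
  intro y
  obtain ⟨⟨y₁, y₂⟩, rfl⟩ := (Fin.appendEquiv m m).surjective y
  show W _ (Fin.append y₁ y₂) = _ * signOf ((Gp w).eval (Fin.append y₁ y₂))
  rw [W_Fp, eval_Gp]
  simp only [signOf_xor, signOf_bd, Literature.Computability.QuantumComplexity.BuzetChailloux.twist_bxor_right]
  rw [twist_comm (bxor w y₁) y₂, Literature.Computability.QuantumComplexity.BuzetChailloux.twist_bxor_right, twist_comm y₂ w, twist_comm y₂ y₁, SgnForrMem.sqrt_two_pow_add_self]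
  ring

/-- HintDial helper `value_Gp` (lens-3 g6 HintDial THEOREMS package; see the enclosing section docstring). -/
theorem value_Gp : (⟨m + m, Fp w, Gp w⟩ : CubicANFPair).value = 1 := forrelation_eq_one_of_isDualOf (isDualOf_Fp_Gp w)

/-- HintDial helper `Gp_const` (lens-3 g6 HintDial THEOREMS package; see the enclosing section docstring). -/
theorem Gp_const : (Gp w).const = decide (Odd (GateFn.numOnes w)) := bd_ones w

/-- HintDial helper `Gp0_eq_of_even` (lens-3 g6 HintDial THEOREMS package; see the enclosing section docstring). -/
theorem Gp0_eq_of_even (h : GateFn.numOnes w % 2 = 0) : Gp0 w = Gp w := by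
  have hc : bd ones w = false := by rw [bd_ones, decide_eq_false]; rw [Nat.odd_iff]; omega
  rw [Gp, hc]; rfl

/-- HintDial helper `Gp0_eq_of_odd` (lens-3 g6 HintDial THEOREMS package; see the enclosing section docstring). -/
theorem Gp0_eq_of_odd (h : ¬ GateFn.numOnes w % 2 = 0) : Gp0 w = flipConst (Gp w) := by
  have hc : bd ones w = true := by rw [bd_ones, decide_eq_true]; rw [Nat.odd_iff]; omega
  rw [Gp, hc]; rfl

/-- ★ THE PLANTED LEVEL-1 INSTANCE. -/
def instP : CubicANFPair := ⟨m + m, Fp w, Gp0 w⟩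

/-- HintDial helper `instP_mem_yes` (lens-3 g6 HintDial THEOREMS package; see the enclosing section docstring). -/
theorem instP_mem_yes (h : GateFn.numOnes w % 2 = 0) : (instP w).encode ∈ SignedExactCubicSliceANF.yes :=
  (CubicANFPair.encode_mem_yes_iff _).2 ⟨⟨m, rfl⟩, by show CubicANFPair.value ⟨m + m, Fp w, Gp0 w⟩ = 1; rw [Gp0_eq_of_even w h]; exact value_Gp w⟩

/-- HintDial helper `instP_mem_no` (lens-3 g6 HintDial THEOREMS package; see the enclosing section docstring). -/
theorem instP_mem_no (h : ¬ GateFn.numOnes w % 2 = 0) : (instP w).encode ∈ SignedExactCubicSliceANF.no :=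
  (CubicANFPair.encode_mem_no_iff _).2 ⟨⟨m, rfl⟩, by
    show CubicANFPair.value ⟨m + m, Fp w, Gp0 w⟩ = -1; rw [Gp0_eq_of_odd w h, value_flipConst, value_Gp]⟩

/-- HintDial helper `isLit_input` (lens-3 g6 HintDial THEOREMS package; see the enclosing section docstring). -/
theorem isLit_input (a : Fin m) : IsLit fun w : Fin m → Bool => w a := ⟨.inr (false, a), fun _ => (Bool.false_xor _).symm⟩

/-- HintDial helper `isLit_Fp_cube` (lens-3 g6 HintDial THEOREMS package; see the enclosing section docstring). -/
theorem isLit_Fp_cube (i j l : Fin (m + m)) : IsLit fun w : Fin m → Bool => (Fp w).cube i j l := by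
  unfold Fp blTable
  refine IsLit.const_and _ ?_
  generalize finSumFinEquiv.symm i = u
  generalize finSumFinEquiv.symm l = v
  rcases u with a | b <;> rcases v with a' | b'
  · exact (isLit_input a).const_and _
  · exact IsLit.const _
  · exact IsLit.const _
  · exact IsLit.const _

/-- HintDial helper `isLit_Gp0_cube` (lens-3 g6 HintDial THEOREMS package; see the enclosing section docstring). -/
theorem isLit_Gp0_cube (i j l : Fin (m + m)) : IsLit fun w : Fin m → Bool => (Gp0 w).cube i j l := by
  unfold Gp0 blTable
  refine IsLit.const_and _ ?_
  generalize finSumFinEquiv.symm i = u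
  generalize finSumFinEquiv.symm l = v
  rcases u with a | b <;> rcases v with a' | b'
  · exact IsLit.const _
  · exact IsLit.const _
  · exact IsLit.const _
  · exact (isLit_input b).const_and _

/-- ★ `w ↦ code(instP w)` IS A LITERAL PROJECTION. -/
theorem isProj_encode_instP : IsProj fun w : Fin m → Bool => (instP w).encode := by
  unfold instP CubicANFPair.encode
  exact (IsProj.const (encodeNat (m + m))).boolPair
    ((isProj_encode_form (fun w => Fp w) false (fun _ => rfl) isLit_Fp_cube).boolPair
      (isProj_encode_form (fun w => Gp0 w) false (fun _ => rfl) isLit_Gp0_cube))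

/-- the length-bounding polynomial in `m` (`n = 2m`). -/
def uPoly2 : Polynomial ℕ :=
  (Polynomial.C 12 * Polynomial.X ^ 3 + Polynomial.C 12 * Polynomial.X ^ 2 + Polynomial.C 8 * Polynomial.X + Polynomial.C 16).comp
    (Polynomial.C 2 * Polynomial.X)

/-- HintDial helper `uPoly2_eval` (lens-3 g6 HintDial THEOREMS package; see the enclosing section docstring). -/
theorem uPoly2_eval (j : ℕ) : uPoly2.eval j = lenB (2 * j) := by
  simp [uPoly2, lenB]

/-- HintDial helper `length_encode_instP_le` (lens-3 g6 HintDial THEOREMS package; see the enclosing section docstring). -/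
theorem length_encode_instP_le : (instP w).encode.length ≤ uPoly2.eval m := by
  rw [uPoly2_eval]
  refine (length_encode_pair_le _).trans (le_of_eq ?_)
  show lenB (m + m) = _
  rw [two_mul]

/-- ★★ NEW THEOREM (g6): the exact signed cubic slice — RungA's OWN object, hint level 1 — is outside `promiseLift AC⁰[p]` for
every ODD prime `p` (PARITY planting + Smolensky `MOD₂ ∉ AC⁰[p]`). -/
theorem signedExact_not_AC0Mod_odd {p : ℕ} (hp : p.Prime) (hp2 : p ≠ 2) :
    SignedExactCubicSliceANF ∉ promiseLift (AC0Mod p) :=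
  not_promiseLift_AC0Mod_of_proj hp Nat.prime_two hp2 _ (fun _ w => (instP w).encode) (fun _ => isProj_encode_instP) uPoly2
    (fun _ w => length_encode_instP_le w) (fun _ w h => instP_mem_yes w h) (fun _ w h => instP_mem_no w h)

end Automaton

end Summit.QuantumAdvantage.QuantumAdvantage.Theorems.HintDial

end
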